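import Mathlib
import HarnessLib
import Literature.Analysis.Matrix.GrothendieckInequality

/-!
# LEMMA S₂ / S₃: the rows of a cut-norm-bounded matrix are `ℓ₁`-summable in `ℓ₂`;
# the middle slices of a cube-bounded trilinear form have `ℓ₁`-summable `ℓ₂` row norms
# (THEOREM R's input norm `K₀(T) ≤ K_G · C₃(T)`, conditional only on `GrothendieckFactorization`)

Solo seat `solo-QuantumAdvantage-informed`, session 16, file 36 (§4.29 (3) of the seat's paper).

LEMMA S₂. If `|sᵀAt| ≤ M` for all sign vectors `s, t` (`‖A‖_{∞→1} ≤ M`, `A` real `m × n`), then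
`Σ_j ‖A_{j·}‖₂ ≤ K_G · M` — Grothendieck's inequality with one side the coordinate basis
(`u_j = A_{j·}/‖A_{j·}‖₂`, `v_k = e_k`). Here it is derived from ANY two-weight factorization
`|xᵀAy| ≤ K‖x‖_{L₂(μ)}‖y‖_{L₂(ν)}` (`Σμ, Σν ≤ 1`): test on `x = U_{·l}` (the `l`-th column of the
row-normalised matrix) and `y = e_l`, sum over `l`, Cauchy–Schwarz
(`row_l2_sum_le_of_factorization`, unconditional); with the named fact `GrothendieckFactorization`
this gives `row_l2_sum_le` (`K = krivineBound`).

LEMMA S₃. For a trilinear `T` with `|T(x,y,z)| ≤ C` on sign vectors and every sign vector `x`, the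
matrix `A^x_{jk} = Σ_i T_{ijk} x_i` has `‖A^x‖_{∞→1} ≤ C`, hence
`Σ_j ‖T(x, e_j, ·)‖₂ ≤ krivineBound · C` (`slice_row_l2_sum_le`): the quantity
`K₀(T) := sup_x Σ_j ‖T(x,e_j,·)‖₂` that norms the operator `Φ : ℓ_∞ → ℓ₁(ℓ₂)` in THEOREM R is at most
`K_G · C₃(T)`. Trust base: Mathlib + the named fact `GrothendieckFactorization` (only for the last two
statements).
-/

namespace Summit.QuantumAdvantage.QuantumAdvantage.Theorems

namespace RowSummability

open Finset Literature.Analysis.Matrix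

variable {m n : ℕ}

/-- Euclidean norm of the `j`-th row. -/
noncomputable def rowNorm (A : Matrix (Fin m) (Fin n) ℝ) (j : Fin m) : ℝ :=
  Real.sqrt (∑ k, A j k ^ 2)

/-- Row norms are nonnegative. -/
theorem rowNorm_nonneg (A : Matrix (Fin m) (Fin n) ℝ) (j : Fin m) : 0 ≤ rowNorm A j :=
  Real.sqrt_nonneg _

/-- The square of the row norm is the row's sum of squares. -/
theorem rowNorm_sq (A : Matrix (Fin m) (Fin n) ℝ) (j : Fin m) :
    rowNorm A j ^ 2 = ∑ k, A j k ^ 2 :=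
  Real.sq_sqrt (sum_nonneg fun _ _ => sq_nonneg _)

/-- Pairing a row with its normalisation returns the row norm (also for a zero row, by `x/0 = 0`). -/
theorem sum_mul_div_rowNorm (A : Matrix (Fin m) (Fin n) ℝ) (j : Fin m) :
    ∑ k, A j k * (A j k / rowNorm A j) = rowNorm A j := by
  have h : ∑ k, A j k * (A j k / rowNorm A j) = (∑ k, A j k ^ 2) / rowNorm A j := by
    rw [Finset.sum_div]
    exact sum_congr rfl fun k _ => by ring
  rw [h, ← rowNorm_sq, pow_two, mul_self_div_self]

/-- The normalised row has Euclidean norm at most one. -/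
theorem sum_div_rowNorm_sq_le_one (A : Matrix (Fin m) (Fin n) ℝ) (j : Fin m) :
    ∑ k, (A j k / rowNorm A j) ^ 2 ≤ 1 := by
  have h : ∑ k, (A j k / rowNorm A j) ^ 2 = (∑ k, A j k ^ 2) / rowNorm A j ^ 2 := by
    rw [Finset.sum_div]
    exact sum_congr rfl fun k _ => by rw [div_pow]
  rw [h, ← rowNorm_sq]
  exact div_self_le_one _

/-- **LEMMA S₂ from a factorization (unconditional).** If `|xᵀAy| ≤ K‖x‖_{L₂(μ)}‖y‖_{L₂(ν)}` for all
real `x, y` with nonnegative weights of mass `≤ 1`, then `Σ_j ‖A_{j·}‖₂ ≤ K`. -/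
theorem row_l2_sum_le_of_factorization (A : Matrix (Fin m) (Fin n) ℝ) {K : ℝ} (hK : 0 ≤ K)
    (μ : Fin m → ℝ) (ν : Fin n → ℝ) (hμ : ∀ j, 0 ≤ μ j) (hν : ∀ k, 0 ≤ ν k)
    (hμ1 : ∑ j, μ j ≤ 1) (hν1 : ∑ k, ν k ≤ 1)
    (hfac : ∀ (x : Fin m → ℝ) (y : Fin n → ℝ), |∑ j, ∑ k, A j k * x j * y k| ≤
      K * Real.sqrt (∑ j, μ j * x j ^ 2) * Real.sqrt (∑ k, ν k * y k ^ 2)) :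
    ∑ j, rowNorm A j ≤ K := by
  classical
  set U : Fin m → Fin n → ℝ := fun j k => A j k / rowNorm A j with hU
  -- Step 1: `Σ_j ‖A_j‖₂ = Σ_l B(U_{·l}, e_l)`.
  have inner : ∀ j l, ∑ k, A j k * U j l * (if k = l then (1:ℝ) else 0) = A j l * U j l := by
    intro j l
    rw [Finset.sum_eq_single l (fun k _ hk => by simp [hk]) (fun h => absurd (mem_univ l) h)]
    simp
  have h1 : ∑ j, rowNorm A j = ∑ l, ∑ j, ∑ k, A j k * U j l * (if k = l then (1:ℝ) else 0) := by
    simp_rw [inner]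
    rw [Finset.sum_comm]
    exact sum_congr rfl fun j _ => (sum_mul_div_rowNorm A j).symm
  -- Step 2: each term is at most `K √(Σ_j μ_j U_{jl}²) √ν_l`.
  have h2 : ∀ l, ∑ j, ∑ k, A j k * U j l * (if k = l then (1:ℝ) else 0)
      ≤ K * Real.sqrt (∑ j, μ j * U j l ^ 2) * Real.sqrt (ν l) := by
    intro l
    have h := hfac (fun j => U j l) (fun k => if k = l then 1 else 0)
    have hy : ∑ k, ν k * (if k = l then (1:ℝ) else 0) ^ 2 = ν l := by
      rw [Finset.sum_eq_single l (fun k _ hk => by simp [hk]) (fun h => absurd (mem_univ l) h)]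
      simp
    rw [hy] at h
    exact le_trans (le_abs_self _) h
  -- Step 3: Cauchy–Schwarz over `l`.
  have ha : ∀ l, 0 ≤ ∑ j, μ j * U j l ^ 2 :=
    fun l => sum_nonneg fun j _ => mul_nonneg (hμ j) (sq_nonneg _)
  have h3 : ∑ l, Real.sqrt (∑ j, μ j * U j l ^ 2) * Real.sqrt (ν l)
      ≤ Real.sqrt (∑ l, ∑ j, μ j * U j l ^ 2) * Real.sqrt (∑ l, ν l) := by
    have hcs := Real.sum_mul_le_sqrt_mul_sqrt (Finset.univ)
      (fun l => Real.sqrt (∑ j, μ j * U j l ^ 2)) (fun l => Real.sqrt (ν l))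
    have e1 : ∑ l, Real.sqrt (∑ j, μ j * U j l ^ 2) ^ 2 = ∑ l, ∑ j, μ j * U j l ^ 2 :=
      sum_congr rfl fun l _ => Real.sq_sqrt (ha l)
    have e2 : ∑ l, Real.sqrt (ν l) ^ 2 = ∑ l, ν l :=
      sum_congr rfl fun l _ => Real.sq_sqrt (hν l)
    rw [e1, e2] at hcs
    exact hcs
  -- Step 4: the two masses are at most one.
  have h4 : ∑ l, ∑ j, μ j * U j l ^ 2 ≤ 1 := by
    rw [Finset.sum_comm]
    have : ∀ j, ∑ l, μ j * U j l ^ 2 ≤ μ j := by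
      intro j
      rw [← Finset.mul_sum]
      calc μ j * ∑ l, U j l ^ 2 ≤ μ j * 1 :=
            mul_le_mul_of_nonneg_left (sum_div_rowNorm_sq_le_one A j) (hμ j)
        _ = μ j := mul_one _
    exact le_trans (sum_le_sum fun j _ => this j) hμ1
  have h5 : Real.sqrt (∑ l, ∑ j, μ j * U j l ^ 2) * Real.sqrt (∑ l, ν l) ≤ 1 := by
    have a1 : Real.sqrt (∑ l, ∑ j, μ j * U j l ^ 2) ≤ 1 := by
      rw [show (1:ℝ) = Real.sqrt 1 from Real.sqrt_one.symm]
      exact Real.sqrt_le_sqrt h4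
    have a2 : Real.sqrt (∑ l, ν l) ≤ 1 := by
      rw [show (1:ℝ) = Real.sqrt 1 from Real.sqrt_one.symm]
      exact Real.sqrt_le_sqrt hν1
    calc Real.sqrt (∑ l, ∑ j, μ j * U j l ^ 2) * Real.sqrt (∑ l, ν l) ≤ 1 * 1 :=
          mul_le_mul a1 a2 (Real.sqrt_nonneg _) zero_le_one
      _ = 1 := one_mul _
  -- Assemble.
  calc ∑ j, rowNorm A j = ∑ l, ∑ j, ∑ k, A j k * U j l * (if k = l then (1:ℝ) else 0) := h1
    _ ≤ ∑ l, K * Real.sqrt (∑ j, μ j * U j l ^ 2) * Real.sqrt (ν l) := sum_le_sum fun l _ => h2 l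
    _ = K * ∑ l, Real.sqrt (∑ j, μ j * U j l ^ 2) * Real.sqrt (ν l) := by
        rw [Finset.mul_sum]; exact sum_congr rfl fun l _ => by ring
    _ ≤ K * (Real.sqrt (∑ l, ∑ j, μ j * U j l ^ 2) * Real.sqrt (∑ l, ν l)) :=
        mul_le_mul_of_nonneg_left h3 hK
    _ ≤ K * 1 := mul_le_mul_of_nonneg_left h5 hK
    _ = K := mul_one _

/-- The sign-vector bound is nonnegative (test on the all-ones vectors). -/
theorem bound_nonneg (A : Matrix (Fin m) (Fin n) ℝ) {M : ℝ}
    (hM : ∀ (s : Fin m → ℝ) (t : Fin n → ℝ), (∀ j, s j = 1 ∨ s j = -1) →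
      (∀ k, t k = 1 ∨ t k = -1) → |∑ j, ∑ k, A j k * s j * t k| ≤ M) : 0 ≤ M :=
  le_trans (abs_nonneg _) (hM (fun _ => 1) (fun _ => 1) (fun _ => Or.inl rfl) (fun _ => Or.inl rfl))

/-- **LEMMA S₂** (with Grothendieck's inequality as the named fact `GrothendieckFactorization`):
`‖A‖_{∞→1} ≤ M ⟹ Σ_j ‖A_{j·}‖₂ ≤ K_G·M` with `K_G ≤ krivineBound`. [cite: Pisier2011, Thm 2.1 p. 9,
applied with `u_j = A_{j·}/‖A_{j·}‖₂`, `v_k = e_k`] -/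
theorem row_l2_sum_le (hGT : GrothendieckFactorization) (A : Matrix (Fin m) (Fin n) ℝ) {M : ℝ}
    (hM : ∀ (s : Fin m → ℝ) (t : Fin n → ℝ), (∀ j, s j = 1 ∨ s j = -1) →
      (∀ k, t k = 1 ∨ t k = -1) → |∑ j, ∑ k, A j k * s j * t k| ≤ M) :
    ∑ j, rowNorm A j ≤ krivineBound * M := by
  obtain ⟨μ, ν, hμ, hν, hμ1, hν1, hfac⟩ := hGT m n A M hM
  exact row_l2_sum_le_of_factorization A (mul_nonneg krivineBound_pos.le (bound_nonneg A hM))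
    μ ν hμ hν hμ1 hν1 hfac

/-- Rearranging the sign-vector pairing of a slice matrix `A^x_{jk} = Σ_i T_{ijk} x_i`. -/
theorem slice_bilin_eq (T : Fin n → Fin n → Fin n → ℝ) (x s t : Fin n → ℝ) :
    ∑ j, ∑ k, (∑ i, T i j k * x i) * s j * t k = ∑ i, ∑ j, ∑ k, T i j k * x i * s j * t k := by
  have e : ∀ j k, (∑ i, T i j k * x i) * s j * t k = ∑ i, T i j k * x i * s j * t k := by
    intro j k; rw [Finset.sum_mul, Finset.sum_mul]
  simp_rw [e]
  calc ∑ j, ∑ k, ∑ i, T i j k * x i * s j * t k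
      = ∑ j, ∑ i, ∑ k, T i j k * x i * s j * t k := sum_congr rfl fun j _ => Finset.sum_comm
    _ = ∑ i, ∑ j, ∑ k, T i j k * x i * s j * t k := Finset.sum_comm

/-- **LEMMA S₃** (`K₀(T) ≤ K_G·C₃(T)`): for a trilinear form bounded by `C` on sign vectors and any
sign vector `x`, the `ℓ₂`-norms of the rows `T(x, e_j, ·)` of the slice `T(x,·,·)` sum to at most
`krivineBound · C`. [cite: Pisier2011, Thm 2.1 p. 9] -/
theorem slice_row_l2_sum_le (hGT : GrothendieckFactorization) (T : Fin n → Fin n → Fin n → ℝ)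
    {C : ℝ}
    (hC : ∀ x y z : Fin n → ℝ, (∀ i, x i = 1 ∨ x i = -1) → (∀ j, y j = 1 ∨ y j = -1) →
      (∀ k, z k = 1 ∨ z k = -1) → |∑ i, ∑ j, ∑ k, T i j k * x i * y j * z k| ≤ C)
    (x : Fin n → ℝ) (hx : ∀ i, x i = 1 ∨ x i = -1) :
    ∑ j, Real.sqrt (∑ k, (∑ i, T i j k * x i) ^ 2) ≤ krivineBound * C := by
  have h := row_l2_sum_le hGT (Matrix.of fun j k => ∑ i, T i j k * x i) (M := C) (by
    intro s t hs ht
    simp only [Matrix.of_apply]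
    rw [slice_bilin_eq]
    exact hC x s t hx hs ht)
  simpa [rowNorm, Matrix.of_apply] using h

/-- Markov count of heavy rows of a slice: if `|Σ_{ijk} T_{ijk} x_i y_j z_k| ≤ C` on sign vectors,
then for every sign vector `x` and `t > 0`, `#{j : ‖T(x,e_j,·)‖₂ ≥ t} ≤ krivineBound·C/t` — the number
of middle coordinates whose row in the slice `T(x,·,·)` is `ℓ₂`-heavy is `O(1/t)`, dimension-free. -/
theorem heavy_slice_rows_card_le (hGT : GrothendieckFactorization) (T : Fin n → Fin n → Fin n → ℝ)
    {C : ℝ}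
    (hC : ∀ x y z : Fin n → ℝ, (∀ i, x i = 1 ∨ x i = -1) → (∀ j, y j = 1 ∨ y j = -1) →
      (∀ k, z k = 1 ∨ z k = -1) → |∑ i, ∑ j, ∑ k, T i j k * x i * y j * z k| ≤ C)
    (x : Fin n → ℝ) (hx : ∀ i, x i = 1 ∨ x i = -1) {t : ℝ} (ht : 0 < t) :
    ((Finset.univ.filter fun j => t ≤ Real.sqrt (∑ k, (∑ i, T i j k * x i) ^ 2)).card : ℝ)
      ≤ krivineBound * C / t := by
  set S := Finset.univ.filter fun j => t ≤ Real.sqrt (∑ k, (∑ i, T i j k * x i) ^ 2) with hS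
  have hsum := slice_row_l2_sum_le hGT T hC x hx
  have h1 : (S.card : ℝ) * t ≤ ∑ j ∈ S, Real.sqrt (∑ k, (∑ i, T i j k * x i) ^ 2) := by
    rw [← nsmul_eq_mul]
    have := Finset.card_nsmul_le_sum S (fun j => Real.sqrt (∑ k, (∑ i, T i j k * x i) ^ 2)) t
      (fun j hj => (Finset.mem_filter.mp hj).2)
    simpa using this
  have h2 : ∑ j ∈ S, Real.sqrt (∑ k, (∑ i, T i j k * x i) ^ 2)
      ≤ ∑ j, Real.sqrt (∑ k, (∑ i, T i j k * x i) ^ 2) :=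
    Finset.sum_le_sum_of_subset_of_nonneg (Finset.filter_subset _ _)
      (fun j _ _ => Real.sqrt_nonneg _)
  rw [le_div_iff₀ ht]
  linarith

end RowSummability

end Summit.QuantumAdvantage.QuantumAdvantage.Theorems
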